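import Summits.SmoothPoincare4.SmoothPoincare4.Theorems.SblfDescentRungOneHelperAnnTwistMaps
import Literature.Topology.FourManifolds.LoopRealisation
import Literature.Topology.FourManifolds.CircleAngleLift
import Mathlib.Analysis.InnerProductSpace.Calculus
import Mathlib.Analysis.SpecialFunctions.SmoothTransition
import HarnessLib

/-!
# The rotation angle of a family of diffeomorphisms of the plane at the origin (annulus twist, layer 3)

Auxiliary file (layer 3) of helper `helper_sliceGluing_annulusTwist`, line `Sketch`, crux
`SblfDescent.RungOne`.

(Crux item stmt-SmoothPoincare4-18531; skeleton `Cruxes/RungOne/Lines/Sketch.lean`.)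

Let `D_t` (`t ∈ ℝ`) be a jointly smooth family of diffeomorphisms of `ℝ²` (with jointly smooth
inverses) which is the identity for `t ≤ 0` and the identity near the origin for `t ≥ 1`.  The
`1`-jet `M_t = D(D_t)(0) ∈ GL₂(ℝ)` is then a smooth loop based at `1`, and the direction of
`M_t e₀` has a smooth **angle function** `α` (tree `AngleLift.angleFun`, `CircleAngleLift.lean`)
with `α = 0` on `t ≤ 0` and `α = 2πk` on `t ≥ 1` for an integer `k` — the **winding number of the
loop `M_t` in `GL₂⁺(ℝ) ≃ SO(2)`** (`AnnulusTwist.exists_angle`).  Moreover the corrected `1`-jet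
`N_t = R(-α(t)) M_t` is upper triangular with positive diagonal in the basis `(e₀, e₁)` (the
Gram–Schmidt normal form; Cerf, LNM 53 (1968), Appendice §5, proof of Prop. 4; tree
`FrameLoop.lean`), so that every segment `(1 - s) N_t + s · 1`, `s ∈ [0, 1]`, is invertible
(`AnnulusTwist.isUnit_segment`) — the hypothesis of the loop realisation theorem
(`exists_diffeotopy_loopRealisation`, `LoopRealisation.lean`).

## References

* J. Cerf, *Sur les difféomorphismes de la sphère de dimension trois (Γ₄ = 0)*, LNM 53 (1968),
  Appendice §5, Proposition 4. [CerfDiffeoSphere1968]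
* M. W. Hirsch, *Differential Topology*, GTM 33 (1976), Ch. 4 §4 (Gram–Schmidt deformation).
  [HirschDT1976]
-/

set_option linter.dupNamespace false

noncomputable section

open scoped ContDiff Topology Real
open Set Function Metric Filter Literature.Topology.FourManifolds

namespace Summit.SmoothPoincare4.SmoothPoincare4.Cruxes.RungOne.Sketch

namespace AnnulusTwist

/-! ### Continuous functions with `cos = 1` on a connected set are constant there -/

/-- A continuous real function with `cos ∘ f = 1` on a preconnected set is constant on it (its
image is an interval contained in `2πℤ`). [folklore] -/
theorem apply_eq_apply_of_cos_eq_one {S : Set ℝ} (hS : IsPreconnected S) {f : ℝ → ℝ}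
    (hf : ContinuousOn f S) (h1 : ∀ t ∈ S, Real.cos (f t) = 1) {a b : ℝ} (ha : a ∈ S) (hb : b ∈ S) :
    f a = f b := by
  by_contra hne
  -- arrange `f a < f b`
  wlog hlt : f a < f b generalizing a b
  · exact this hb ha (Ne.symm hne) (lt_of_le_of_ne (not_lt.1 hlt) (Ne.symm hne))
  obtain ⟨m, hm⟩ := (Real.cos_eq_one_iff (f a)).1 (h1 a ha)
  obtain ⟨m', hm'⟩ := (Real.cos_eq_one_iff (f b)).1 (h1 b hb)
  have hmm' : (m : ℝ) < m' := by
    have : (m : ℝ) * (2 * π) < m' * (2 * π) := by rw [hm, hm']; exact hlt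
    exact lt_of_mul_lt_mul_right this (by positivity)
  have hmm'1 : (m : ℝ) + 1 ≤ m' := by exact_mod_cast (show m + 1 ≤ m' by exact_mod_cast hmm')
  -- the image is an interval, so it contains `f a + π`
  have himg : IsPreconnected (f '' S) := hS.image f hf
  have hIcc : Icc (f a) (f b) ⊆ f '' S := himg.Icc_subset (mem_image_of_mem f ha) (mem_image_of_mem f hb)
  have hmid : f a + π ∈ Icc (f a) (f b) := by
    constructor
    · linarith [Real.pi_pos]
    · rw [← hm, ← hm']; nlinarith [Real.pi_pos]
  obtain ⟨t, ht, hft⟩ := hIcc hmid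
  have := h1 t ht
  rw [hft, ← hm, Real.cos_add_pi, Real.cos_int_mul_two_pi] at this
  norm_num at this

/-! ### The `1`-jet at the origin of a family of diffeomorphisms -/

/-- The coordinate vector `e₀ = (1, 0)` of `ℝ²`. [folklore] -/
abbrev e0 : EuclideanSpace ℝ (Fin 2) := EuclideanSpace.single 0 1

/-- The coordinate vector `e₁ = (0, 1)` of `ℝ²`. [folklore] -/
abbrev e1 : EuclideanSpace ℝ (Fin 2) := EuclideanSpace.single 1 1

/-- Expansion of a vector of `ℝ²` in the basis `(e₀, e₁)`. [folklore] -/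
theorem eq_smul_e0_add_smul_e1 (z : EuclideanSpace ℝ (Fin 2)) : z = z 0 • e0 + z 1 • e1 := by
  ext i; fin_cases i <;> simp

variable {D Dinv : ℝ → EuclideanSpace ℝ (Fin 2) → EuclideanSpace ℝ (Fin 2)}

/-- A slice of a jointly smooth family is smooth. [folklore] -/
theorem contDiff_slice' (hD : ContDiff ℝ ∞ (uncurry D)) (t : ℝ) : ContDiff ℝ ∞ (D t) :=
  hD.comp (contDiff_prodMk_right t)

/-- **The `1`-jet `t ↦ D(D_t)(0)` of a jointly smooth family is smooth.** [folklore] -/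
theorem contDiff_fderiv_zero (hD : ContDiff ℝ ∞ (uncurry D)) :
    ContDiff ℝ ∞ fun t => fderiv ℝ (D t) 0 :=
  hD.fderiv contDiff_const (by simp)

/-- **The `1`-jet of a stage of a family of diffeomorphisms is injective** (chain rule on the
left inverse). [folklore] -/
theorem injective_fderiv_zero (hD : ContDiff ℝ ∞ (uncurry D)) (hDinv : ContDiff ℝ ∞ (uncurry Dinv))
    (hinv : ∀ t z, Dinv t (D t z) = z) (t : ℝ) : Injective (fderiv ℝ (D t) 0) := by
  have hd : DifferentiableAt ℝ (D t) 0 := ((contDiff_slice' hD t).differentiable (by simp)) 0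
  have hd' : DifferentiableAt ℝ (Dinv t) (D t 0) :=
    ((contDiff_slice' hDinv t).differentiable (by simp)) _
  have hcomp : (fderiv ℝ (Dinv t) (D t 0)).comp (fderiv ℝ (D t) 0) = ContinuousLinearMap.id ℝ _ := by
    rw [← fderiv_comp 0 hd' hd]
    have : Dinv t ∘ D t = id := funext fun z => hinv t z
    rw [this, fderiv_id]
  intro x y hxy
  have := congrArg (fderiv ℝ (Dinv t) (D t 0)) hxy
  rwa [← ContinuousLinearMap.comp_apply, ← ContinuousLinearMap.comp_apply, hcomp] at this

/-- The `1`-jet of the identity stages is the identity. [folklore] -/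
theorem fderiv_zero_of_eventuallyEq_id {f : EuclideanSpace ℝ (Fin 2) → EuclideanSpace ℝ (Fin 2)}
    (h : ∀ᶠ z in 𝓝 (0 : EuclideanSpace ℝ (Fin 2)), f z = z) :
    fderiv ℝ f 0 = ContinuousLinearMap.id ℝ _ := by
  rw [Filter.EventuallyEq.fderiv_eq (show f =ᶠ[𝓝 0] id from h)]
  exact fderiv_id

/-! ### Upper triangular maps with positive diagonal: the segment to the identity is invertible -/

/-- The inner product with `e₁` is the second coordinate. [folklore] -/
theorem inner_e1_left (z : EuclideanSpace ℝ (Fin 2)) : inner ℝ e1 z = z 1 := by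
  rw [EuclideanSpace.inner_single_left]; simp

/-- **Kernel criterion.** An injective linear map `N` of `ℝ²` with `N e₀ ∈ ℝ e₀`, `N e₀ ≠ 0`,
has `(N e₁)₁ ≠ 0` (else `N e₁` and `N e₀` would be proportional). [folklore] -/
theorem apply_e1_one_ne_zero (N : EuclideanSpace ℝ (Fin 2) →L[ℝ] EuclideanSpace ℝ (Fin 2))
    (hN : Injective N) {n : ℝ} (hn : n ≠ 0) (he0 : N e0 = n • e0) : (N e1) 1 ≠ 0 := by
  intro h
  -- the vector `w = (N e₁)₀ e₀ - n e₁ ≠ 0` lies in the kernel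
  set w : EuclideanSpace ℝ (Fin 2) := (N e1) 0 • e0 - n • e1 with hw
  have hw0 : w ≠ 0 := by
    intro h0
    have : w 1 = 0 := by rw [h0]; rfl
    simp [hw, hn] at this
  have hexp : N e1 = (N e1) 0 • e0 := by
    have := eq_smul_e0_add_smul_e1 (N e1)
    rwa [h, zero_smul, add_zero] at this
  have hNw : N w = 0 := by
    have : N w = ((N e1) 0 * n) • e0 - n • N e1 := by
      rw [hw, map_sub, map_smul, map_smul, he0, smul_smul]
    rw [this, mul_comm, ← smul_smul, ← hexp, sub_self]
  exact hw0 (hN (by rw [hNw, map_zero]))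

/-- **The segment from an upper triangular map with positive diagonal to the identity consists
of invertible maps** (`2 × 2` case of flag-positivity, tree `FrameLoop.isUnit_segment_of_flagPositive`).
[cite: HirschDT1976, Ch. 4 §4] -/
theorem isUnit_segment_of_triangular (N : EuclideanSpace ℝ (Fin 2) →L[ℝ] EuclideanSpace ℝ (Fin 2))
    {n : ℝ} (hn : 0 < n) (he0 : N e0 = n • e0) (hpos : 0 < (N e1) 1) {s : ℝ} (hs : s ∈ Icc (0 : ℝ) 1) :
    IsUnit ((1 - s) • N + s • (1 : EuclideanSpace ℝ (Fin 2) →L[ℝ] EuclideanSpace ℝ (Fin 2))) := by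
  refine isUnit_of_injective_clm ?_
  set S := (1 - s) • N + s • (1 : EuclideanSpace ℝ (Fin 2) →L[ℝ] EuclideanSpace ℝ (Fin 2)) with hS
  have hSapp : ∀ z, S z = (1 - s) • N z + s • z := fun z => rfl
  -- the diagonal coefficients are positive
  have hd0 : 0 < (1 - s) * n + s := by
    rcases eq_or_lt_of_le hs.2 with rfl | hs1
    · norm_num
    · nlinarith [hs.1]
  have hd1 : 0 < (1 - s) * (N e1) 1 + s := by
    rcases eq_or_lt_of_le hs.2 with rfl | hs1
    · norm_num
    · nlinarith [hs.1]
  have hSe0 : S e0 = ((1 - s) * n + s) • e0 := by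
    rw [hSapp, he0, smul_smul, add_smul]
  have hSe1_1 : (S e1) 1 = (1 - s) * (N e1) 1 + s := by
    rw [hSapp]; simp
  suffices hker : ∀ z, S z = 0 → z = 0 by
    intro x y hxy
    exact sub_eq_zero.1 (hker (x - y) (by rw [map_sub, hxy, sub_self]))
  intro z hz
  have hexp := eq_smul_e0_add_smul_e1 z
  have hSz : S z = z 0 • S e0 + z 1 • S e1 := by
    conv_lhs => rw [hexp]
    rw [map_add, map_smul, map_smul]
  -- second coordinate: `z 1 = 0`
  have hz1 : z 1 = 0 := by
    have := congrArg (fun v : EuclideanSpace ℝ (Fin 2) => v 1) hSz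
    simp only [hz, hSe0, smul_smul] at this
    simp only [PiLp.zero_apply, PiLp.add_apply, PiLp.smul_apply, smul_eq_mul, hSe1_1] at this
    have h' : z 1 * ((1 - s) * (N e1) 1 + s) = 0 := by
      have h'' : (e0 : EuclideanSpace ℝ (Fin 2)) 1 = 0 := by simp
      rw [h''] at this; linarith
    rcases mul_eq_zero.1 h' with h | h
    · exact h
    · exact absurd h hd1.ne'
  -- first coordinate: `z 0 = 0`
  have hz0 : z 0 = 0 := by
    have := congrArg (fun v : EuclideanSpace ℝ (Fin 2) => v 0) hSz
    simp only [hz, hSe0, hz1, zero_smul, add_zero, smul_smul] at this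
    simp only [PiLp.zero_apply, PiLp.smul_apply, smul_eq_mul] at this
    have h' : z 0 * ((1 - s) * n + s) = 0 := by
      have h'' : (e0 : EuclideanSpace ℝ (Fin 2)) 0 = 1 := by simp
      rw [h''] at this; linarith
    rcases mul_eq_zero.1 h' with h | h
    · exact h
    · exact absurd h hd0.ne'
  rw [hexp, hz0, hz1, zero_smul, zero_smul, add_zero]

/-- A continuous real function on `ℝ` which is positive at `0` and never vanishes is positive.
[folklore] -/
theorem pos_of_ne_zero_of_pos_zero {g : ℝ → ℝ} (hg : Continuous g) (h0 : 0 < g 0) (hne : ∀ t, g t ≠ 0)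
    (t : ℝ) : 0 < g t := by
  by_contra hle
  rw [not_lt] at hle
  obtain ⟨c, -, hc⟩ : ∃ c ∈ Set.uIcc t 0, g c = 0 := by
    have hmem : (0 : ℝ) ∈ Set.uIcc (g t) (g 0) := Set.mem_uIcc.2 (Or.inl ⟨hle, h0.le⟩)
    exact intermediate_value_uIcc hg.continuousOn hmem
  exact hne c hc

/-! ### The angle function of the `1`-jet loop -/

/-- **The rotation angle of a family of diffeomorphisms at the origin.** Let `D_t` be a jointly
smooth family of self-maps of `ℝ²` with jointly smooth left inverses, equal to the identity for
`t ≤ 0` and to the identity near `0` for `t ≥ 1`.  Then there are a smooth `α : ℝ → ℝ` and an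
integer `k` (the winding number of the `1`-jet loop) with `α = 0` on `t ≤ 0`, `α = 2πk` on
`t ≥ 1`, such that `R(-α(t)) D(D_t)(0) e₀ = ‖D(D_t)(0) e₀‖ e₀` with `‖D(D_t)(0) e₀‖ > 0`, and
every segment `(1 - s) R(-α(t)) D(D_t)(0) + s · 1`, `s ∈ [0, 1]`, is invertible.
[cite: CerfDiffeoSphere1968, Appendice §5, Proposition 4] -/
theorem exists_angle (hD : ContDiff ℝ ∞ (uncurry D)) (hDinv : ContDiff ℝ ∞ (uncurry Dinv))
    (hinv : ∀ t z, Dinv t (D t z) = z) (h0 : ∀ t ≤ (0 : ℝ), ∀ z, D t z = z)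
    (h1 : ∀ t, (1 : ℝ) ≤ t → ∀ᶠ z in 𝓝 (0 : EuclideanSpace ℝ (Fin 2)), D t z = z) :
    ∃ (α : ℝ → ℝ) (k : ℤ), ContDiff ℝ ∞ α ∧ (∀ t ≤ (0 : ℝ), α t = 0) ∧
      (∀ t, (1 : ℝ) ≤ t → α t = 2 * π * k) ∧
      (∀ t, ∀ s ∈ Icc (0 : ℝ) 1,
        IsUnit ((1 - s) • (rotL (-α t)).comp (fderiv ℝ (D t) 0) +
          s • (1 : EuclideanSpace ℝ (Fin 2) →L[ℝ] EuclideanSpace ℝ (Fin 2)))) ∧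
      (∀ t, fderiv ℝ (D t) 0 e0 = ‖fderiv ℝ (D t) 0 e0‖ • rotL (α t) e0) := by
  set M : ℝ → EuclideanSpace ℝ (Fin 2) →L[ℝ] EuclideanSpace ℝ (Fin 2) := fun t => fderiv ℝ (D t) 0
    with hM
  have hMs : ContDiff ℝ ∞ M := contDiff_fderiv_zero hD
  have hMinj : ∀ t, Injective (M t) := injective_fderiv_zero hD hDinv hinv
  -- `M t = 1` for `t ≤ 0` and for `t ≥ 1`
  have hMid : ∀ t, t ≤ 0 ∨ 1 ≤ t → M t = ContinuousLinearMap.id ℝ _ := by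
    rintro t (ht | ht)
    · exact fderiv_zero_of_eventuallyEq_id (Filter.Eventually.of_forall (h0 t ht))
    · exact fderiv_zero_of_eventuallyEq_id (h1 t ht)
  -- the vector `v t = M t e₀ ≠ 0` and its direction
  set v : ℝ → EuclideanSpace ℝ (Fin 2) := fun t => M t e0 with hv
  have hvs : ContDiff ℝ ∞ v := hMs.clm_apply contDiff_const
  have hv0 : ∀ t, v t ≠ 0 := fun t h => by
    have : M t e0 = M t 0 := by rw [map_zero]; exact h
    have := hMinj t this
    have h' := congrArg (fun z : EuclideanSpace ℝ (Fin 2) => z 0) this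
    simp at h'
  have hvid : ∀ t, t ≤ 0 ∨ 1 ≤ t → v t = e0 := fun t ht => by
    simp only [hv, hMid t ht, ContinuousLinearMap.id_apply]
  have hns : ContDiff ℝ ∞ fun t => ‖v t‖ := hvs.norm ℝ hv0
  have hnpos : ∀ t, 0 < ‖v t‖ := fun t => norm_pos_iff.2 (hv0 t)
  set c : ℝ → ℝ := fun t => (v t) 0 / ‖v t‖ with hc
  set sn : ℝ → ℝ := fun t => (v t) 1 / ‖v t‖ with hsn
  have hcs : ContDiff ℝ ∞ c := ((contDiff_euclidean.1 hvs) 0).div hns fun t => (hnpos t).ne'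
  have hsns : ContDiff ℝ ∞ sn := ((contDiff_euclidean.1 hvs) 1).div hns fun t => (hnpos t).ne'
  have hcs1 : ∀ t, c t ^ 2 + sn t ^ 2 = 1 := fun t => by
    simp only [hc, hsn, div_pow]
    rw [← add_div, ← show ‖v t‖ ^ 2 = (v t) 0 ^ 2 + (v t) 1 ^ 2 by
      rw [EuclideanSpace.real_norm_sq_eq, Fin.sum_univ_two], div_self (pow_ne_zero 2 (hnpos t).ne')]
  have hcid : ∀ t, t ≤ 0 ∨ 1 ≤ t → c t = 1 ∧ sn t = 0 := fun t ht => by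
    simp only [hc, hsn, hvid t ht]
    simp
  -- the angle function
  set α := AngleLift.angleFun c sn 0 with hα
  have hαs : ContDiff ℝ ∞ α := AngleLift.contDiff_angleFun hcs hsns 0
  have h0c : Real.cos 0 = c 0 := by rw [Real.cos_zero, (hcid 0 (Or.inl le_rfl)).1]
  have h0s : Real.sin 0 = sn 0 := by rw [Real.sin_zero, (hcid 0 (Or.inl le_rfl)).2]
  have hcos : ∀ t, Real.cos (α t) = c t :=
    AngleLift.cos_angleFun (hcs.of_le (mod_cast le_top)) (hsns.of_le (mod_cast le_top)) hcs1 h0c h0s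
  have hsin : ∀ t, Real.sin (α t) = sn t :=
    AngleLift.sin_angleFun (hcs.of_le (mod_cast le_top)) (hsns.of_le (mod_cast le_top)) hcs1 h0c h0s
  have hα0 : α 0 = 0 := AngleLift.angleFun_zero 0
  -- `α` is constant on `t ≤ 0` and on `t ≥ 1`
  have hαle : ∀ t ≤ (0 : ℝ), α t = 0 := fun t ht => by
    rw [← hα0]
    exact apply_eq_apply_of_cos_eq_one isPreconnected_Iic hαs.continuous.continuousOn
      (fun u hu => by rw [hcos, (hcid u (Or.inl hu)).1]) ht (Set.mem_Iic.2 le_rfl)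
  obtain ⟨k, hk⟩ : ∃ k : ℤ, (k : ℝ) * (2 * π) = α 1 :=
    (Real.cos_eq_one_iff (α 1)).1 (by rw [hcos, (hcid 1 (Or.inr le_rfl)).1])
  have hαge : ∀ t, (1 : ℝ) ≤ t → α t = 2 * π * k := fun t ht => by
    rw [show 2 * π * k = α 1 by rw [← hk]; ring]
    exact apply_eq_apply_of_cos_eq_one isPreconnected_Ici hαs.continuous.continuousOn
      (fun u hu => by rw [hcos, (hcid u (Or.inr hu)).1]) ht (Set.mem_Ici.2 le_rfl)
  -- the corrected jet `N t = R(-α t) M t` is upper triangular with positive diagonal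
  have hve : ∀ t, v t = ‖v t‖ • rotL (α t) e0 := fun t => by
    rw [rotL_single_zero, hcos, hsin]
    refine ext2 ?_ ?_
    · have hne := (hnpos t).ne'
      simp [hc, hsn]; field_simp
    · have hne := (hnpos t).ne'
      simp [hc, hsn]; field_simp
  have hNe0 : ∀ t, (rotL (-α t)).comp (M t) e0 = ‖v t‖ • e0 := fun t => by
    rw [ContinuousLinearMap.comp_apply]
    change rotL (-α t) (v t) = _
    conv_lhs => rw [hve t, map_smul, rotL_neg_rotL]
  have hNinj : ∀ t, Injective ((rotL (-α t)).comp (M t)) := fun t => by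
    intro x y hxy
    simp only [ContinuousLinearMap.comp_apply] at hxy
    have := congrArg (rotL (α t)) hxy
    rw [rotL_rotL_neg, rotL_rotL_neg] at this
    exact hMinj t this
  have hNne : ∀ t, ((rotL (-α t)).comp (M t) e1) 1 ≠ 0 := fun t =>
    apply_e1_one_ne_zero _ (hNinj t) (hnpos t).ne' (hNe0 t)
  -- the lower diagonal entry is positive: it is continuous, `1` at `t = 0`, never `0`
  have hgcont : Continuous fun t => ((rotL (-α t)).comp (M t) e1) 1 := by
    have hw : Continuous fun t => M t e1 := (hMs.clm_apply contDiff_const).continuous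
    have e : (fun t => ((rotL (-α t)).comp (M t) e1) 1) =
        fun t => Real.sin (-α t) * (M t e1) 0 + Real.cos (-α t) * (M t e1) 1 := by
      funext t; rw [ContinuousLinearMap.comp_apply, rotL_apply_one]
    rw [e]
    have hw0 : Continuous fun t => (M t e1) 0 := (contDiff_euclidean.1 (hMs.clm_apply contDiff_const) 0).continuous
    have hw1 : Continuous fun t => (M t e1) 1 := (contDiff_euclidean.1 (hMs.clm_apply contDiff_const) 1).continuous
    exact ((Real.continuous_sin.comp hαs.continuous.neg).mul hw0).add
      ((Real.continuous_cos.comp hαs.continuous.neg).mul hw1)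
  have hg0 : 0 < ((rotL (-α 0)).comp (M 0) e1) 1 := by
    rw [hα0, neg_zero, ContinuousLinearMap.comp_apply, rotL_zero_apply, hMid 0 (Or.inl le_rfl)]
    simp
  have hgpos : ∀ t, 0 < ((rotL (-α t)).comp (M t) e1) 1 :=
    pos_of_ne_zero_of_pos_zero hgcont hg0 hNne
  refine ⟨α, k, hαs, hαle, hαge, fun t s hs => ?_, hve⟩
  exact isUnit_segment_of_triangular _ (hnpos t) (hNe0 t) (hgpos t) hs

end AnnulusTwist

/-- **Registered sub-helper `helper_ann_frame`** (layer 3 of `helper_sliceGluing_annulusTwist`):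
the smooth angle function of the `1`-jet loop of a family of diffeomorphisms of the plane, with
its integer winding number (`AnnulusTwist.exists_angle`, without the invertibility clause).
[cite: CerfDiffeoSphere1968, Appendice §5, Proposition 4] -/
theorem helper_ann_frame : ∀ (D Dinv : ℝ → EuclideanSpace ℝ (Fin 2) → EuclideanSpace ℝ (Fin 2)), ContDiff ℝ ∞ (Function.uncurry D) → ContDiff ℝ ∞ (Function.uncurry Dinv) → (∀ t z, Dinv t (D t z) = z) → (∀ t ≤ (0 : ℝ), ∀ z, D t z = z) → (∀ t, (1 : ℝ) ≤ t → ∀ᶠ z in nhds (0 : EuclideanSpace ℝ (Fin 2)), D t z = z) → ∃ (α : ℝ → ℝ) (k : ℤ), ContDiff ℝ ∞ α ∧ (∀ t ≤ (0 : ℝ), α t = 0) ∧ (∀ t, (1 : ℝ) ≤ t → α t = 2 * Real.pi * k) ∧ (∀ t, (fderiv ℝ (D t) 0 (EuclideanSpace.single 0 1)) 0 = ‖fderiv ℝ (D t) 0 (EuclideanSpace.single 0 1)‖ * Real.cos (α t) ∧ (fderiv ℝ (D t) 0 (EuclideanSpace.single 0 1)) 1 = ‖fderiv ℝ (D t) 0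 (EuclideanSpace.single 0 1)‖ * Real.sin (α t)) := by
  intro D Dinv hD hDinv hinv h0 h1
  obtain ⟨α, k, hαs, hα0, hα1, -, hve⟩ := AnnulusTwist.exists_angle hD hDinv hinv h0 h1
  refine ⟨α, k, hαs, hα0, hα1, fun t => ?_⟩
  have h := hve t
  rw [AnnulusTwist.rotL_single_zero] at h
  constructor
  · conv_lhs => rw [h]
    simp
  · conv_lhs => rw [h]
    simp

end Summit.SmoothPoincare4.SmoothPoincare4.Cruxes.RungOne.Sketch

end
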